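import Summits.BirchSwinnertonDyer.Rank1Residual.Supersingular.X7KimTamDefectShapeLValues
import HarnessLib

/-!
# N5 record shape, RAW-DATUM form (class X7, `r_an = 0`, `p ≥ 5`, `surj(p)`): `BSD(E,p)` from the literal equation, a CYCLIC
# two-prime Kolyvagin level `ℓ₁ℓ₂ ∈ 𝒩_k` certified in the kernel, and ONE depth-`k` Kurihara number `δ̃_{ℓ₁ℓ₂}^{(k)} ≢ 0 (mod p^k)`
# with `k ≤ ord_p ∏c_ℓ + 1` — the X7 twin of x10b gen 13's `X6RankZero.bsdp_of_kimLower_of_prop48_of_ainvs`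

Cell `b2b-bsdres`, supersingular family, prover A = unit `b2b-bsdres-x10b` (gen 30).  Topic file; namespace
`Summit.BirchSwinnertonDyer.Rank1Residual.Supersingular`.  ONE THEOREM, a composition of tree theorems BY NAME (gen 17's class form
`X7RankZero.bsdp_of_kimLower_of_prop48`, additive-p3's `classX7_of_intModel`, `Additive.isKolyvaginPrime_of_intModel_of_card`,
`CyclicityLadder.forall_card_torsion_le_of_level`, gen 13's `surjective_family_of_mem_primeFactors_mul`); no named fact minted, no
definition, debt 0; nothing asserted about any curve; nothing booked; X7 stays CONSTRUCTION-SHAPED (RESIDUAL-MAP §I N5).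

HONEST FRAMING (run/shared/lean/b2b/bsd-rank1-residual/, verbatim in every file): the goal of the
cell is to DELETE the COMBINATION-SHAPED residual classes of the Birch–Swinnerton-Dyer formula for
ALL analytic-rank `≤ 1` elliptic curves over `ℚ` — "full BSD formula for every rank `≤ 1` curve in
class `C`" assembled STRICTLY from published theorems — so that the rank-`≤ 1` remainder becomes
exactly the CONSTRUCTION-SHAPED classes, which are TYPED (missing-input `Prop`s), NOT attempted.
This is not "finishing BSD".

## Why this file exists

The tree's X7 twins of the N4 TAM-DEFECT shapes (`X7KimTamDefectShapeLValues.lean`, gen 17) take the Kurihara number in the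
STANDARD CURRENCY of the certified-series engine (a landed `CertifiedK` row + `validHasseK` rounding certificate + an `L`-value
enclosure `hballL`).  The N5 cells still WITHOUT any per-pair kernel theorem after gen 28 are exactly those where that currency is
out of reach (X7-KURIHARA.md §20.2 / §30: the cost cells `385020j1 @ 19`, `448844f1 @ 19`, `455715s1 @ 29` — cheapest cyclic
two-prime levels `1.7·10⁸ … 3.4·10⁸`, i.e. `2.6·10¹¹ … 1.9·10¹²` twisted-series terms — and the TAM cell `405450dd1 @ 7`, depth `2`,
`ψ(N) = 1 049 760`).  Since gen 28 the cell has a second instrument that does not sum any series: the EXACT plus modular-symbol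
eigen-functional of `f_E` on all of `P¹(ℤ/N)` (clean-room Manin-symbol adapter `symq.py` on the engines kernel `exactrec.sparsenull`,
kernel dimension `1` CERTIFIED; homology pin `re Λ_f = ℤ·Ω⁺_f/2`; X6-KURIHARA.md §28, record `X6KimTamDefectRecordsB.lean`), from which a
Kurihara number at a level `n` costs `φ(n)` continued fractions.  Its output is the RAW datum `δ̃_n^{(k)} mod p^k`, so the records need
the raw-datum record shape — for X6 that is gen 13's `X6RankZero.bsdp_of_kimLower_of_prop48_of_ainvs`; this file is its X7 twin
(class X7 read off the model by an ADDITIVE prime `q ∣ Δ`, `q ∣ c₄`; `surj(p)` a per-pair DATA binder, on N5 discharged BY NAME by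
prover B's / this seat's `surj_x7r0_<label>_<p>` certificates).

## What this file proves

* `X7RankZero.bsdp_of_kimLower_of_prop48_of_ainvs` — the literal-equation RECORD SHAPE at a two-prime level `ℓ₁ℓ₂ ∈ 𝒩_k`:
  minimality as a hypothesis (factored Kraus per record), `p ∤ Δ`, `countPoints … p = n_p` with `p ∣ p + 1 − n_p` (good supersingular,
  `a_p = 0` since `p ≥ 5`), an additive prime `q` (`q ∣ Δ`, `q ∣ c₄`) — class X7 via `classX7_of_intModel` —, `surj(p)` as DATA; the
  Kolyvagin primes from point counts (`ℓᵢ ∤ Δ`, `ℓᵢ ≡ 1 (mod p^k)`, `p^k ∣ #Ẽ(𝔽_ℓᵢ)`); CYCLICITY as two per-prime hypotheses in the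
  literal-model form (`card_torsion_le_of_count` when `p² ∤ #Ẽ(𝔽_ℓ)`, else `card_torsion_le_of_ladder`); `ψ` ANY family surjective at
  `ℓ₁, ℓ₂`; REMAINING HYPOTHESES = EXACTLY `hKimL` (Kim 2026 Thm. 1.8 (6) = arXiv Thm. 1.9 (6), PUBLISHED), `h48` (Perrin-Riou 2003
  Prop. 4.8, PUBLISHED), `hGZK`, `hmod`; the data binders `r_an = 0`, `k ≤ ord_p ∏c_ℓ + 1` (Cremona), `D` with `p ∤ c_D`, the period
  transfer `hper`, and `hδ : kuriharaNumber D.f (p^k) (ℓ₁ℓ₂) ψ ≠ 0` (independent of the choice of the surjective `ψ_ℓ`: `δ̃_n` is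
  multilinear in them).

Per pair; NOT a class theorem; nothing booked.  First consumers: `X7KimExactSymbolRecords*.lean` (this gen).

References: C.-H. Kim, AJM 148 (2026) Thm. 1.8 (6), §1.2.2, §1.4.3, §1.5.1–1.5.3 [Kim2022StructureSelmer]; B. Perrin-Riou, Exp. Math.
12 (2003) Prop. 4.8 [PerrinRiou2003]; K. Kato, Astérisque 295 (2004) (12.5.2) [Kato2004Asterisque]; J. H. Silverman, AEC VII.1, VII.5
[SilvermanAEC2009]; K. Ireland – M. Rosen, Prop. 5.1.2, §8.1 [IrelandRosen1990]; R. L. Miller, LMS JCM 14 (2011) Def. 1.1 [Miller2011LMS];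
tree files `X4/KuriharaLowerHalf.lean`, `Supersingular/X7KimTamDefectShapeLValues.lean`, `X6KimTamDefectShape.lean`, `CyclicityLadder.lean`.
-/

set_option autoImplicit false

noncomputable section

open scoped Classical MatrixGroups ModularForm

open CongruenceSubgroup WeierstrassCurve Literature.NumberTheory.EllipticCurves
  Literature.NumberTheory.EllipticCurves.ModularForms
  Literature.NumberTheory.EllipticCurves.Rank1Residual
  Literature.NumberTheory.EllipticCurves.Rank1Residual.Typed
  Literature.NumberTheory.EllipticCurves.Rank1Residual.X11RankOneCertificates
  Summit.BirchSwinnertonDyer.BirchSwinnertonDyer.Rank1Residual.IntModel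
  Summit.BirchSwinnertonDyer.BirchSwinnertonDyer.Rank1Residual.X11RankOne
  Summit.BirchSwinnertonDyer.Rank1Residual.X11b
  Summit.BirchSwinnertonDyer.Rank1Residual.Additive
  Summit.BirchSwinnertonDyer.Rank1Residual.Supersingular.KuriharaTwist

namespace Summit.BirchSwinnertonDyer.Rank1Residual.Supersingular

/-- **N5 RECORD SHAPE, RAW DATUM — `BSD(E,p)` on X7 ∧ `surj(p)` ∧ `r_an = 0` ∧ `p ≥ 5` from the literal equation, a CYCLIC two-prime
level `ℓ₁ℓ₂ ∈ 𝒩_k` certified in the kernel, and ONE depth-`k` Kurihara number `δ̃_{ℓ₁ℓ₂}^{(k)} ≢ 0 (mod p^k)` with `k ≤ ord_p ∏c_ℓ + 1`.**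
Decidable inputs (per record): minimality (hypothesis; factored Kraus), `p ∤ Δ`, `countPoints … p = n_p` with `p ∣ p + 1 − n_p`, an
ADDITIVE prime `q ∣ Δ`, `q ∣ c₄` (class X7 via `classX7_of_intModel`); `ℓᵢ ∤ Δ`, `ℓᵢ ≡ 1 (mod p^k)`, `countPoints … ℓᵢ = nᵢ`, `p^k ∣ nᵢ`
(Kolyvagin primes of depth `k`); the two CYCLICITY bounds `#Ẽ(𝔽_ℓᵢ)[p] ≤ p` in the literal-model form.  REMAINING HYPOTHESES = EXACTLY
`hKimL`, `h48` (PUBLISHED), `hGZK`, `hmod`; the data binders `hsurj`, `r_an = 0`, `k ≤ ord_p ∏c_ℓ + 1` (Cremona), `D` with `p ∤ c_D`, the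
period transfer `hper`; a family `ψ` surjective at `ℓ₁, ℓ₂`; and `hδ : kuriharaNumber D.f (p^k) (ℓ₁ℓ₂) ψ ≠ 0`.  Lower half: Kim 2026
Thm. 1.9 (6); upper half: Perrin-Riou Prop. 4.8 (both inside `X7RankZero.bsdp_of_kimLower_of_prop48`).  Per pair; NOT a class theorem;
nothing booked. [cite: Kim2022StructureSelmer, Thm. 1.9 (6) (PDF p. 8), §1.2.2 (PDF p. 5) and §1.5.1–1.5.3 (PDF pp. 7–8)]
[cite: PerrinRiou2003, Prop. 4.8 (p. 162)] [cite: SilvermanAEC2009, VII.1 Remark 1.1, VII.5 Prop. 5.1(a) and (b)]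
[cite: IrelandRosen1990, Prop. 5.1.2 and §8.1] [cite: Miller2011LMS, Def. 1.1] -/
theorem X7RankZero.bsdp_of_kimLower_of_prop48_of_ainvs
    (hKimL : Kim2026.rankZero_le_padicValNat_sha_of_kuriharaNumber_ne_zero)
    (h48 : PerrinRiou2003.prop48_padicValRat_bsd_rank_zero_le)
    (hGZK : rank_eq_analyticRank_of_analyticRank_le_one) (hmod : hasEntireLFunction_rat)
    (a1 a2 a3 a4 a6 : ℤ) (hmin : (⟨a1, a2, a3, a4, a6⟩ : WeierstrassCurve ℚ).IsGloballyMinimal)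
    (p : ℕ) [Fact p.Prime] (hp5 : 5 ≤ p)
    -- class X7 at `p` from the model: good supersingular at `p` + an additive prime `q`; `surj(p)` is DATA
    (hpΔ : ¬ (p : ℤ) ∣ discOf [a1, a2, a3, a4, a6]) {np : ℕ} (hcnt : countPoints [a1, a2, a3, a4, a6] p = np)
    (hap : (p : ℤ) ∣ (p : ℤ) + 1 - np)
    (q : ℕ) (hq : q.Prime) (hqΔ : (q : ℤ) ∣ discOf [a1, a2, a3, a4, a6]) (hqc₄ : (q : ℤ) ∣ c4Of [a1, a2, a3, a4, a6])
    (hsurj : Surj (⟨a1, a2, a3, a4, a6⟩ : WeierstrassCurve ℚ) p)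
    -- the cyclic level `ℓ₁ℓ₂ ∈ 𝒩_k`
    (k : ℕ) (hk : 1 ≤ k) (ℓ₁ ℓ₂ : ℕ) [Fact ℓ₁.Prime] [Fact ℓ₂.Prime] (hne : ℓ₁ ≠ ℓ₂)
    (hℓ₁p : ℓ₁ ≠ p) (hℓ₂p : ℓ₂ ≠ p) (hℓ₁2 : ℓ₁ ≠ 2) (hℓ₂2 : ℓ₂ ≠ 2)
    (hℓ₁Δ : ¬ (ℓ₁ : ℤ) ∣ discOf [a1, a2, a3, a4, a6]) (hℓ₂Δ : ¬ (ℓ₂ : ℤ) ∣ discOf [a1, a2, a3, a4, a6])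
    (h1₁ : ℓ₁ ≡ 1 [MOD p ^ k]) (h1₂ : ℓ₂ ≡ 1 [MOD p ^ k]) {n₁ n₂ : ℕ}
    (hc₁ : countPoints [a1, a2, a3, a4, a6] ℓ₁ = n₁) (hc₂ : countPoints [a1, a2, a3, a4, a6] ℓ₂ = n₂)
    (hd₁ : p ^ k ∣ n₁) (hd₂ : p ^ k ∣ n₂)
    (hcyc₁ : Nat.card {P : (((⟨a1, a2, a3, a4, a6⟩ : WeierstrassCurve ℤ)).map
        (Int.castRingHom (ZMod ℓ₁))).toAffine.Point // p • P = 0} ≤ p)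
    (hcyc₂ : Nat.card {P : (((⟨a1, a2, a3, a4, a6⟩ : WeierstrassCurve ℤ)).map
        (Int.castRingHom (ZMod ℓ₂))).toAffine.Point // p • P = 0} ≤ p)
    -- data binders
    (hr0 : (⟨a1, a2, a3, a4, a6⟩ : WeierstrassCurve ℚ).analyticRank = 0)
    (hkt : k ≤ padicValNat p (⟨a1, a2, a3, a4, a6⟩ : WeierstrassCurve ℚ).tamagawaProduct + 1)
    {N : ℕ} [NeZero N] (D : ModularParametrizationData (⟨a1, a2, a3, a4, a6⟩ : WeierstrassCurve ℚ) N)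
    (hc : ¬ (p : ℤ) ∣ D.maninConstant)
    (hper : ∃ u : ℚ, ‖(u : ℚ_[p])‖ = 1 ∧
      (⟨a1, a2, a3, a4, a6⟩ : WeierstrassCurve ℚ).realPeriodRat = u * plusPeriod D.f)
    (ψ : (ℓ : ℕ) → (ZMod ℓ)ˣ →* Multiplicative (ZMod (p ^ k)))
    (hψ₁ : Function.Surjective (ψ ℓ₁)) (hψ₂ : Function.Surjective (ψ ℓ₂))
    (hδ : kuriharaNumber D.f (p ^ k) (ℓ₁ * ℓ₂) ψ ≠ 0) :
    BSDp (⟨a1, a2, a3, a4, a6⟩ : WeierstrassCurve ℚ) p := by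
  have h0 : discOf [a1, a2, a3, a4, a6] ≠ 0 := fun h ↦ hpΔ (by rw [h]; exact dvd_zero _)
  haveI := isElliptic_of_discOf_ne_zero a1 a2 a3 a4 a6 h0
  haveI := hmin
  have hp2 : p ≠ 2 := by omega
  have hI : integralModelInt (⟨a1, a2, a3, a4, a6⟩ : WeierstrassCurve ℚ) = ⟨a1, a2, a3, a4, a6⟩ :=
    integralModelInt_eq_of_map_eq _ (map_mk_int a1 a2 a3 a4 a6)
  have hN₁ := natCard_point_eq_of_countPoints a1 a2 a3 a4 a6 ℓ₁ hℓ₁2 hℓ₁Δ hc₁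
  have hN₂ := natCard_point_eq_of_countPoints a1 a2 a3 a4 a6 ℓ₂ hℓ₂2 hℓ₂Δ hc₂
  -- class X7 at `p`
  have hX : ClassX7 (⟨a1, a2, a3, a4, a6⟩ : WeierstrassCurve ℚ) p :=
    classX7_of_intModel p hI (by rw [intCurve_Δ]; exact hpΔ)
      (natCard_point_eq_of_countPoints a1 a2 a3 a4 a6 p hp2 hpΔ hcnt) hap q hq
      (by rw [intCurve_Δ]; exact hqΔ) (by rw [intCurve_c₄]; exact hqc₄)
  -- the Kolyvagin level of depth `k`
  have hK₁ : Kato.IsKolyvaginPrime (⟨a1, a2, a3, a4, a6⟩ : WeierstrassCurve ℚ) p k ℓ₁ :=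
    Additive.isKolyvaginPrime_of_intModel_of_card hI p k ℓ₁ hℓ₁p (by rw [intCurve_Δ]; exact hℓ₁Δ) h1₁ hN₁ hd₁
  have hK₂ : Kato.IsKolyvaginPrime (⟨a1, a2, a3, a4, a6⟩ : WeierstrassCurve ℚ) p k ℓ₂ :=
    Additive.isKolyvaginPrime_of_intModel_of_card hI p k ℓ₂ hℓ₂p (by rw [intCurve_Δ]; exact hℓ₂Δ) h1₂ hN₂ hd₂
  have hn : Kato.IsKolyvaginProduct (⟨a1, a2, a3, a4, a6⟩ : WeierstrassCurve ℚ) p k (ℓ₁ * ℓ₂) :=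
    Additive.isKolyvaginProduct_mul hK₁ hK₂ hne
  haveI : NeZero (ℓ₁ * ℓ₂) := ⟨Nat.mul_ne_zero (Fact.out : ℓ₁.Prime).ne_zero (Fact.out : ℓ₂.Prime).ne_zero⟩
  -- cyclicity at both level primes, in the consumer's `integralModelInt` form
  have hcyc : ∀ (ℓ : ℕ) [Fact ℓ.Prime], ℓ ∣ ℓ₁ * ℓ₂ →
      Nat.card {P : ((WeierstrassCurve.integralModelInt (⟨a1, a2, a3, a4, a6⟩ : WeierstrassCurve ℚ)).map
          (Int.castRingHom (ZMod ℓ))).toAffine.Point // p • P = 0} ≤ p := by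
    rw [hI]
    exact forall_card_torsion_le_of_level ⟨a1, a2, a3, a4, a6⟩ p (ℓ₁ * ℓ₂) ℓ₁ ℓ₂ rfl hcyc₁ hcyc₂
  exact X7RankZero.bsdp_of_kimLower_of_prop48 _ p hKimL h48 hGZK hmod hp5 hX hsurj hr0 D hc hper k (ℓ₁ * ℓ₂) hk hkt hn
    hcyc ψ (surjective_family_of_mem_primeFactors_mul Fact.out Fact.out ψ hψ₁ hψ₂) hδ

end Summit.BirchSwinnertonDyer.Rank1Residual.Supersingular

end
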